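import Summits.AtomisticToContinuum.Crystallization.Theorems.SquareWellLayerCakeGapTwelveToBarlowCombinatorialLayeringGradedData
import Summits.AtomisticToContinuum.Crystallization.Theorems.SquareWellLayerCakeGapTwelveToBarlowCombinatorialLayeringCharts
import Summits.AtomisticToContinuum.Crystallization.Theorems.PalmUnimodularRigidityShellsToBarlowChartTransportOpsDefs

/-!
# Combinatorial layering (B1a of `GapTwelveToBarlow`): chart type and base frames

Crux `SquareWellLayerCake.GapTwelveToBarlow` (stmt-AtomisticToContinuum-15807), line `Sketch`,
stub `stub_develop` (H_develop); first file of the INSTANTIATION of the graded finite development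
on the charted window of the stub.

* `zchart_hcp_iff` / `zchart_type_unique` (anchor) — two integer charts at the same site have the
  same TYPE: a relabelling would be an isomorphism between the cuboctahedral and the
  anticuboctahedral contact graphs, but adjacent vertices of the cuboctahedron have at most one
  common neighbour (`fcc_common_le_one`) while the anticuboctahedron has a vertex with a bonded
  2-path in its star (`hcp_two_path`).  So "hcp-like site" is well defined from ANY chart.
* `hcpBaseFrame`, `fccBaseFrame` — the explicit base frames of parity `+1` (by `decide`), and
  `image_tables` (the two tables enumerate `fcc3Int`, `hcpInt`).

Nothing is defined; no named fact is used.
-/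

namespace Summit.AtomisticToContinuum.Crystallization.Theorems.SquareWellLayerCakeGapTwelveToBarlow

open Literature.Geometry.DiscreteGeometry Literature.MathematicalPhysics.StatisticalMechanics
open Summit.AtomisticToContinuum.Crystallization.Theorems.PalmUnimodularRigidityShellsToBarlowChart
  (fcc3Int sqNormInt_neg IsFrame frameParity)

/-! ## The two chart types cannot coexist at a site -/

/-- In the cuboctahedral contact graph two adjacent vertices have at most one common neighbour
(every edge lies in exactly one triangle). [folklore] -/
theorem fcc_common_le_one : ∀ v m : Fin 12, fccAdj v m →
    (Finset.univ.filter fun a : Fin 12 => fccAdj v a ∧ fccAdj m a).card ≤ 1 := by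
  decide

/-- In the anticuboctahedral contact graph the star of the hexagonal vertex `0` contains the
bonded 2-path `7 – 5 – 10`. [folklore] -/
theorem hcp_two_path : hcpAdj 0 7 ∧ hcpAdj 0 5 ∧ hcpAdj 0 10 ∧ hcpAdj 7 5 ∧ hcpAdj 5 10 ∧
    (7 : Fin 12) ≠ 10 := by
  decide

/-- An hcp-type chart and an fcc-type chart cannot label the neighbours of the same site: the
relabelling would be an isomorphism of the two (non-isomorphic) contact graphs. [folklore] -/
theorem false_of_zchart_hcp_fcc {N : ℕ} (x : Fin N → EuclideanSpace ℝ (Fin 3)) (j : Fin N)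
    {e e' : Fin 12 → Fin N} (hinj : Function.Injective e)
    (hnb : ∀ a : Fin 12, e a ≠ j ∧ dist (x j) (x (e a)) ≤ 1)
    (hadj : ∀ a b : Fin 12, a ≠ b → (dist (x (e a)) (x (e b)) ≤ 1 ↔ sqNormInt (hcpTab a - hcpTab b) = 18))
    (hsurj' : ∀ k : Fin N, k ≠ j → dist (x j) (x k) ≤ 1 → ∃ a : Fin 12, e' a = k)
    (hadj' : ∀ a b : Fin 12, a ≠ b →
      (dist (x (e' a)) (x (e' b)) ≤ 1 ↔ sqNormInt (3 • fccTab a - 3 • fccTab b) = 18)) : False := by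
  classical
  have hσ0 : ∀ a : Fin 12, ∃ a' : Fin 12, e' a' = e a := fun a => hsurj' (e a) (hnb a).1 (hnb a).2
  choose σ hσ using hσ0
  have hσinj : Function.Injective σ := fun a b h => hinj (by rw [← hσ a, ← hσ b, h])
  have key : ∀ a b : Fin 12, a ≠ b → hcpAdj a b → fccAdj (σ a) (σ b) := by
    intro a b hab h
    rw [fccAdj_iff_sqNormInt_three, ← hadj' _ _ (hσinj.ne hab), hσ, hσ]
    exact (hadj a b hab).2 h
  obtain ⟨h07, h05, h010, h75, h510, hne⟩ := hcp_two_path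
  have c1 := key _ _ (by decide) h07
  have c2 := key _ _ (by decide) h05
  have c3 := key _ _ (by decide) h010
  have c4 := key _ _ (by decide) h75
  have c5 := key _ _ (by decide) h510
  have hcard := fcc_common_le_one (σ 0) (σ 5) c2
  have hm7 : σ 7 ∈ Finset.univ.filter fun a : Fin 12 => fccAdj (σ 0) a ∧ fccAdj (σ 5) a := by
    rw [Finset.mem_filter]
    refine ⟨Finset.mem_univ _, c1, ?_⟩
    have := c4; rwa [fccAdj, ← sqNormInt_neg, neg_sub] at this
  have hm10 : σ 10 ∈ Finset.univ.filter fun a : Fin 12 => fccAdj (σ 0) a ∧ fccAdj (σ 5) a := by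
    rw [Finset.mem_filter]
    exact ⟨Finset.mem_univ _, c3, c5⟩
  exact hne (hσinj (Finset.card_le_one.1 hcard _ hm7 _ hm10))

/-- **Chart type is determined by the site**: two integer charts `(T, e)`, `(T', e')` at the same
site are both hcp-type or both fcc-type. [folklore] -/
theorem zchart_hcp_iff {N : ℕ} (x : Fin N → EuclideanSpace ℝ (Fin 3)) (j : Fin N)
    {T T' : Fin 12 → Fin 3 → ℤ} {e e' : Fin 12 → Fin N}
    (hc : (((T = fun a : Fin 12 => 3 • fccTab a) ∨ T = hcpTab) ∧ Function.Injective e ∧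
      (∀ a : Fin 12, e a ≠ j ∧ dist (x j) (x (e a)) ≤ 1) ∧
      (∀ k : Fin N, k ≠ j → dist (x j) (x k) ≤ 1 → ∃ a : Fin 12, e a = k) ∧
      (∀ a b : Fin 12, a ≠ b → (dist (x (e a)) (x (e b)) ≤ 1 ↔ sqNormInt (T a - T b) = 18))))
    (hc' : (((T' = fun a : Fin 12 => 3 • fccTab a) ∨ T' = hcpTab) ∧ Function.Injective e' ∧
      (∀ a : Fin 12, e' a ≠ j ∧ dist (x j) (x (e' a)) ≤ 1) ∧
      (∀ k : Fin N, k ≠ j → dist (x j) (x k) ≤ 1 → ∃ a : Fin 12, e' a = k) ∧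
      (∀ a b : Fin 12, a ≠ b → (dist (x (e' a)) (x (e' b)) ≤ 1 ↔ sqNormInt (T' a - T' b) = 18)))) :
    T = hcpTab ↔ T' = hcpTab := by
  obtain ⟨hT, hinj, hnb, hsurj, hadj⟩ := hc
  obtain ⟨hT', hinj', hnb', hsurj', hadj'⟩ := hc'
  constructor
  · intro h
    rcases hT' with h' | h'
    · subst h h'
      exact (false_of_zchart_hcp_fcc x j hinj hnb hadj hsurj' hadj').elim
    · exact h'
  · intro h'
    rcases hT with h | h
    · subst h h'
      exact (false_of_zchart_hcp_fcc x j hinj' hnb' hadj' hsurj hadj).elim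
    · exact h


/-- **Chart type is determined by the site** (closed form; the registered anchor of this file):
two integer charts at the same site are both hcp-type or both fcc-type. [folklore] -/
theorem zchart_type_unique :
    ∀ (N : ℕ) (x : Fin N → EuclideanSpace ℝ (Fin 3)) (j : Fin N) (T T' : Fin 12 → Fin 3 → ℤ) (e
    e' : Fin 12 → Fin N), (((T = fun a : Fin 12 => 3 •
    Literature.Geometry.DiscreteGeometry.fccTab a) ∨ T =
    Literature.Geometry.DiscreteGeometry.hcpTab) ∧ Function.Injective e ∧ (∀ a : Fin 12, e a ≠ j
    ∧ dist (x j) (x (e a)) ≤ 1) ∧ (∀ k : Fin N, k ≠ j → dist (x j) (x k) ≤ 1 → ∃ a : Fin 12, e a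
    = k) ∧ (∀ a b : Fin 12, a ≠ b → (dist (x (e a)) (x (e b)) ≤ 1 ↔
    Literature.Geometry.DiscreteGeometry.sqNormInt (T a - T b) = 18))) → (((T' = fun a : Fin 12
    => 3 • Literature.Geometry.DiscreteGeometry.fccTab a) ∨ T' =
    Literature.Geometry.DiscreteGeometry.hcpTab) ∧ Function.Injective e' ∧ (∀ a : Fin 12, e' a ≠
    j ∧ dist (x j) (x (e' a)) ≤ 1) ∧ (∀ k : Fin N, k ≠ j → dist (x j) (x k) ≤ 1 → ∃ a : Fin 12,
    e' a = k) ∧ (∀ a b : Fin 12, a ≠ b → (dist (x (e' a)) (x (e' b)) ≤ 1 ↔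
    Literature.Geometry.DiscreteGeometry.sqNormInt (T' a - T' b) = 18))) → (T =
    Literature.Geometry.DiscreteGeometry.hcpTab ↔ T' =
    Literature.Geometry.DiscreteGeometry.hcpTab) :=
  fun _ x j _ _ _ _ hc hc' => zchart_hcp_iff x j hc hc'

/-! ## Base frames -/

/-- The base frame at an hcp-like site (directions `(−3,3,0)`, `(−3,0,3)` of the hexagonal layer,
upper cap the upper triangle) is a valid frame of parity `+1`. [folklore] -/
theorem hcpBaseFrame :
    IsFrame hcpInt ![-3, 3, 0] ![-3, 0, 3] {![0, 3, 3], ![3, 0, 3], ![3, 3, 0]} ∧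
      frameParity ![-3, 3, 0] ![-3, 0, 3] {![0, 3, 3], ![3, 0, 3], ![3, 3, 0]} = 1 := by
  constructor <;> decide

/-- The base frame at an fcc-like site (directions `(3,3,0)`, `(3,0,3)`, even upper cap) is a
valid frame of parity `+1`. [folklore] -/
theorem fccBaseFrame :
    IsFrame fcc3Int ![3, 3, 0] ![3, 0, 3] {![0, 3, 3], ![-3, 0, 3], ![-3, 3, 0]} ∧
      frameParity ![3, 3, 0] ![3, 0, 3] {![0, 3, 3], ![-3, 0, 3], ![-3, 3, 0]} = 1 := by
  constructor <;> decide

/-- The two tables enumerate the two patterns. [folklore] -/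
theorem image_tables : (Finset.univ.image fun a : Fin 12 => 3 • fccTab a) = fcc3Int ∧
    Finset.univ.image hcpTab = hcpInt := by
  constructor <;> decide

end Summit.AtomisticToContinuum.Crystallization.Theorems.SquareWellLayerCakeGapTwelveToBarlow
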